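/-
Copyright (c) 2026. All rights reserved.
Released under Apache 2.0 license as described in the file LICENSE.
Authors: abc-iut cell, fact-proving seat abc-iut-f-102 (block F, tranche 102, gen 2).
-/
import Literature.AnabelianGeometry.AbsoluteAnabelian.DiagramChainFamilies
import Literature.AnabelianGeometry.AbsoluteAnabelian.DiagramShiftInvariance
import Literature.AnabelianGeometry.AbsoluteAnabelian.LogFrobeniusShiftActionInvariance
import HarnessLib

/-!
# [AbsTopIII] Corollary 5.5 (v): the SHIFT-INVARIANT PART of a family of homotopies on `D•⊢` (toolkit for F-0157 ⟸ F-0159)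

S. Mochizuki, *Topics in absolute anabelian geometry III: global reconstruction algorithms*,
J. Math. Sci. Univ. Tokyo 22 (2015) 939–1156 [MochizukiAbsTopIII2015]; locators `p.N` = pages of the
author's manuscript (`paper:url-5493eb38cbb7`): §0 p. 26 (saturated sets), Def 3.5 (ii) p. 75 (families of
homotopies; the three axioms), Def 3.5 (v) p. 76 (compatibility of a 1-morphism with families of homotopies),
Cor 5.5 (v) pp. 131–132 (the `ℤ`-action `⋎ ↦ ⋎ + k` on `D•` "compatible with the families of homotopies that
constitute the cores and observables of (i), (iii)"; proof p. 133: "immediate from the definitions").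

Companion of `LogFrobeniusRigidity.lean` (abc-iut-L4-t3: `Cor55ShiftAction` = FACT-LIST F-0157, `RealisesCor55Families` =
F-0159, the shifts `shiftOneMorphism k` with identity vertex functors `shiftApp`) and of this seat's
`LogFrobeniusShiftActionInvariance.lean` (`cor55ShiftAction_iff_exists_shiftInvariant`).  For EVERY setting `L` and EVERY
family of homotopies `K` on `D•⊢` this file constructs the **shift-invariant part** `K^ℤ` of `K`: `ShiftInvariantE K` = the
pairs `(γ₁,γ₂) ∈ E_K` all of whose shifts `(γ₁ + k, γ₂ + k)` lie in `E_K` with the SAME homotopy components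
(heterogeneously — the categories at `𝒳_⋎` and `𝒳_{⋎+k}` coincide); it is SATURATED (`shiftInvariantE_isSaturated`: the
three axioms of Def 3.5 (ii) transport invariance along identities, composites and whiskerings, since `shift^* D•⊢ = D•⊢`,
`diagram_comapAlong_shiftGraph`), so `shiftInvariantPart K := K|_{ShiftInvariantE K}` (abc-iut-L4-t12's
`HomotopyFamily.restrictBoundary`) is a family of homotopies with the homotopies of `K`, shift-invariant in exactly the
form of `cor55ShiftAction_iff_exists_shiftInvariant` (`shiftInvariantPart_E_iff_shift`, `shiftInvariantPart_η_app_heq`);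
whence `cor55ShiftAction_of_realises_shiftInvariantPart`: **if the shift-invariant part of some family realises the cores
of Cor 5.5 (i) and the observables of (iii) (`RealisesCor55Families K^ℤ`), then `Cor55ShiftAction L` (F-0157) holds.**

The sequel shows that `K^ℤ` realises (i)/(iii) whenever `K` does, i.e. F-0157 ⟺ `∃ K, RealisesCor55Families K`.  Pure
bookkeeping over the typed interface; refereed pre-IUT material; nothing here bears on [IUTchIII] Cor. 3.12; typed ≠ proved.
-/

set_option autoImplicit false

universe v u w

open CategoryTheory Quiver

namespace Literature.AnabelianGeometry.AbsoluteAnabelian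

/-! ## Heterogeneous bookkeeping across propositionally equal categories -/

section HEqKit

/-- Heterogeneously equal functors agree on objects (Def 3.5 (i) bookkeeping). [cite: MochizukiAbsTopIII2015, Definition 3.5 (i) p.74] -/
theorem Functor.obj_heq_of_heq' {A A' B B' : Type u} [iA : Category.{v} A] [iA' : Category.{v} A']
    [iB : Category.{v} B] [iB' : Category.{v} B'] (hA : A = A') (hiA : HEq iA iA') (hB : B = B')
    (hiB : HEq iB iB') {P : A ⥤ B} {P' : A' ⥤ B'} (hP : HEq P P') {x : A} {x' : A'} (hx : HEq x x') :
    HEq (P.obj x) (P'.obj x') := by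
  subst hA; subst hB; cases hiA; cases hiB; cases hP; cases hx; rfl

/-- Heterogeneously equal functors agree on morphisms (Def 3.5 (i) bookkeeping). [cite: MochizukiAbsTopIII2015, Definition 3.5 (i) p.74] -/
theorem Functor.map_heq_of_heq' {A A' B B' : Type u} [iA : Category.{v} A] [iA' : Category.{v} A']
    [iB : Category.{v} B] [iB' : Category.{v} B'] (hA : A = A') (hiA : HEq iA iA') (hB : B = B')
    (hiB : HEq iB iB') {P : A ⥤ B} {P' : A' ⥤ B'} (hP : HEq P P') {x y : A} {x' y' : A'} (hx : HEq x x')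
    (hy : HEq y y') {f : x ⟶ y} {f' : x' ⟶ y'} (hf : HEq f f') : HEq (P.map f) (P'.map f') := by
  subst hA; subst hB; cases hiA; cases hiB; cases hP; cases hx; cases hy; cases hf; rfl

/-- Identities of heterogeneously equal objects agree (Def 3.5 (ii) bookkeeping). [cite: MochizukiAbsTopIII2015, Definition 3.5 (ii) p.75] -/
theorem CategoryTheory.id_heq_of_heq_obj {C C' : Type u} [i : Category.{v} C] [i' : Category.{v} C'] (hC : C = C')
    (hi : HEq i i') {X : C} {X' : C'} (hX : HEq X X') : HEq (𝟙 X) (𝟙 X') := by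
  subst hC; cases hi; cases hX; rfl

/-- Composites of heterogeneously equal morphisms agree (Def 3.5 (ii) bookkeeping). [cite: MochizukiAbsTopIII2015, Definition 3.5 (ii) p.75] -/
theorem CategoryTheory.comp_heq_of_heq {C C' : Type u} [i : Category.{v} C] [i' : Category.{v} C'] (hC : C = C')
    (hi : HEq i i') {X Y Z : C} {X' Y' Z' : C'} (hX : HEq X X') (hY : HEq Y Y') (hZ : HEq Z Z') {f : X ⟶ Y}
    {g : Y ⟶ Z} {f' : X' ⟶ Y'} {g' : Y' ⟶ Z'} (hf : HEq f f') (hg : HEq g g') : HEq (f ≫ g) (f' ≫ g') := by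
  subst hC; cases hi; cases hX; cases hY; cases hZ; cases hf; cases hg; rfl

/-- Any element of a type equal to `D.obj a` is heterogeneously an element of `D.obj a`. [folklore] -/
private theorem exists_heq_cast {A A' : Type u} (h : A' = A) (x' : A') : ∃ x : A, HEq x' x := by
  subst h; exact ⟨x', HEq.rfl⟩

end HEqKit

/-! ## Generic: the whiskering axiom of Def 3.5 (ii) componentwise; boundary pairs along equal paths -/

namespace DiagramOfCategories

variable {V : Type w} [Quiver.{v} V] {D : DiagramOfCategories.{v, u, w} V}

/-- **Def 3.5 (ii), third axiom, componentwise and without `eqToHom`s**: the homotopy of the whiskered pair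
`([γ₃]∘[γ₁]∘[γ₄], [γ₃]∘[γ₂]∘[γ₄])` at an object `x` is `𝒟_[γ₃](ζ_ϖ)` at `𝒟_[γ₄](x)`, heterogeneously (for any membership
proof of the whiskered pair — proof irrelevance). [cite: MochizukiAbsTopIII2015, Definition 3.5 (ii) p.75] -/
theorem HomotopyFamily.η_app_heq_map_of_whisker (K : D.HomotopyFamily) {a b c d : V} {p q : Path a b}
    (h : K.E p q) (r₁ : Path c a) (r₂ : Path b d) (h' : K.E (r₁.comp (p.comp r₂)) (r₁.comp (q.comp r₂)))
    (x : D.obj c) :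
    HEq ((K.η h').app x) ((D.pathFunctor r₂).map ((K.η h).app ((D.pathFunctor r₁).obj x))) := by
  rw [show K.η h' = K.η (K.isSaturated.precomp (K.isSaturated.postcomp h r₂) r₁) from rfl, K.η_whisker h r₁ r₂,
    app_eqToHom_whisker]
  exact eqToHom_comp_comp_eqToHom_heq_of_heq _ _ _ HEq.rfl

/-- Pre-composition only (third axiom with trivial right whisker): the homotopy of `([γ₁]∘[γ₄], [γ₂]∘[γ₄])` at `x` is
`ζ_ϖ` at `𝒟_[γ₄](x)`, heterogeneously. [cite: MochizukiAbsTopIII2015, Definition 3.5 (ii) p.75] -/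
theorem HomotopyFamily.η_app_heq_of_precomp (K : D.HomotopyFamily) {a b c : V} {p q : Path a b} (h : K.E p q)
    (r₁ : Path c a) (h' : K.E (r₁.comp p) (r₁.comp q)) (x : D.obj c) :
    HEq ((K.η h').app x) ((K.η h).app ((D.pathFunctor r₁).obj x)) := by
  refine (K.η_app_heq_map_of_whisker h r₁ Path.nil h' x).trans ?_
  rw [D.pathFunctor_nil_map]
  exact eqToHom_comp_comp_eqToHom_heq_of_heq _ _ _ HEq.rfl

/-- Boundary pairs along equal pairs with propositionally equal end-vertices. [cite: MochizukiAbsTopIII2015, Definition 3.5 (ii) p.75] -/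
theorem HomotopyFamily.E_iff_of_heq (K : D.HomotopyFamily) {a a' b b' : V} (ha : a = a') (hb : b = b')
    {p q : Path a b} {p' q' : Path a' b'} (hp : HEq p p') (hq : HEq q q') : K.E p q ↔ K.E p' q' := by
  subst ha hb; cases hp; cases hq; exact Iff.rfl

/-- Homotopies along equal pairs with propositionally equal end-vertices agree. [cite: MochizukiAbsTopIII2015, Definition 3.5 (ii) p.75] -/
theorem HomotopyFamily.η_heq_of_heq (K : D.HomotopyFamily) {a a' b b' : V} (ha : a = a') (hb : b = b')
    {p q : Path a b} {p' q' : Path a' b'} (hp : HEq p p') (hq : HEq q q') (h : K.E p q) (h' : K.E p' q') :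
    HEq (K.η h) (K.η h') := by
  subst ha hb; cases hp; cases hq; rfl

/-- Components of homotopies along equal pairs at equal objects agree. [cite: MochizukiAbsTopIII2015, Definition 3.5 (ii) p.75] -/
theorem HomotopyFamily.η_app_heq_of_heq (K : D.HomotopyFamily) {a a' b b' : V} (ha : a = a') (hb : b = b')
    {p q : Path a b} {p' q' : Path a' b'} (hp : HEq p p') (hq : HEq q q') (h : K.E p q) (h' : K.E p' q')
    {x : D.obj a} {x' : D.obj a'} (hx : HEq x x') : HEq ((K.η h).app x) ((K.η h').app x') := by
  subst ha hb; cases hp; cases hq; cases hx; rfl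

end DiagramOfCategories

/-! ## `D•⊢` is invariant under the shifts of its oriented graph -/

namespace LogFrobeniusSetting

open DiagramOfCategories

variable {Vmod : Type u} {isArc : Vmod → Bool} (L : LogFrobeniusSetting Vmod isArc)

/-- **`shift^* D•⊢ = D•⊢`**: pulling `D•⊢` back along the shift `⋎ ↦ ⋎ + k` of its oriented graph gives `D•⊢` again (the
categories at `𝒳_⋎` and `𝒳_{⋎+k}` are the same category `Th•_T[Z]`, the arrows `log`, `id_⋎` carry the same functors).
[cite: MochizukiAbsTopIII2015, Cor 5.5 (v) p. 132] -/
theorem diagram_comapAlong_shiftGraph (k : ℤ) : L.diagram.comapAlong (DVertex.shiftGraph k) = L.diagram := by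
  symm
  refine DiagramOfCategories.eq_comapAlong L.diagram (DVertex.shiftGraph k) (fun a => ?_) (fun a => ?_) (fun e => ?_)
  · cases a <;> rfl
  · cases a <;> rfl
  · -- the `log` arrow is the only one moved: the shifted arrow is a transported `log` arrow
    cases e <;> first
      | exact HEq.rfl
      | exact heq_of_eq (L.functor_shiftHom_log k _).symm

/-- The path functor of a shifted path is that of the path. [cite: MochizukiAbsTopIII2015, Cor 5.5 (v) p. 132] -/
theorem pathFunctor_shift_heq (k : ℤ) {a b : DVertex Vmod isArc} (p : Path a b) :
    HEq (L.diagram.pathFunctor ((DVertex.shiftGraph k).mapPath p)) (L.diagram.pathFunctor p) :=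
  L.diagram.pathFunctor_mapPath_heq (DVertex.shiftGraph k) (L.diagram_comapAlong_shiftGraph k) p

/-- The categories at `x` and `x + k` have the same objects. [cite: MochizukiAbsTopIII2015, Cor 5.5 (v) p. 132] -/
theorem obj_shift_eq (k : ℤ) (a : DVertex Vmod isArc) : L.diagram.obj ((DVertex.shiftGraph k).obj a) = L.diagram.obj a :=
  L.diagram.obj_eq_of_comapAlong_eq (DVertex.shiftGraph k) (L.diagram_comapAlong_shiftGraph k) a

/-- … and the same category structure (heterogeneously). [cite: MochizukiAbsTopIII2015, Cor 5.5 (v) p. 132] -/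
theorem cat_shift_heq (k : ℤ) (a : DVertex Vmod isArc) :
    HEq (L.diagram.cat ((DVertex.shiftGraph k).obj a)) (L.diagram.cat a) :=
  L.diagram.cat_heq_of_comapAlong_eq (DVertex.shiftGraph k) (L.diagram_comapAlong_shiftGraph k) a

/-- The identity vertex functors of the shift fix objects (heterogeneously). [cite: MochizukiAbsTopIII2015, Cor 5.5 (v) p. 132] -/
theorem shiftApp_obj_heq (k : ℤ) (a : DVertex Vmod isArc) (x : L.diagram.obj a) :
    HEq ((L.shiftApp k a).obj x) x := by
  cases a <;> exact HEq.rfl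

/-- Shifted path functors agree with the path functors on objects. [cite: MochizukiAbsTopIII2015, Cor 5.5 (v) p. 132] -/
theorem pathFunctor_shift_obj_heq (k : ℤ) {a b : DVertex Vmod isArc} (p : Path a b) {x : L.diagram.obj a}
    {x' : L.diagram.obj ((DVertex.shiftGraph k).obj a)} (hx : HEq x' x) :
    HEq ((L.diagram.pathFunctor ((DVertex.shiftGraph k).mapPath p)).obj x') ((L.diagram.pathFunctor p).obj x) :=
  Functor.obj_heq_of_heq' (L.obj_shift_eq k a) (L.cat_shift_heq k a) (L.obj_shift_eq k b) (L.cat_shift_heq k b)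
    (L.pathFunctor_shift_heq k p) hx

/-- … and on morphisms. [cite: MochizukiAbsTopIII2015, Cor 5.5 (v) p. 132] -/
theorem pathFunctor_shift_map_heq (k : ℤ) {a b : DVertex Vmod isArc} (p : Path a b) {x y : L.diagram.obj a}
    {x' y' : L.diagram.obj ((DVertex.shiftGraph k).obj a)} (hx : HEq x' x) (hy : HEq y' y) {f : x ⟶ y}
    {f' : x' ⟶ y'} (hf : HEq f' f) :
    HEq ((L.diagram.pathFunctor ((DVertex.shiftGraph k).mapPath p)).map f') ((L.diagram.pathFunctor p).map f) :=
  Functor.map_heq_of_heq' (L.obj_shift_eq k a) (L.cat_shift_heq k a) (L.obj_shift_eq k b) (L.cat_shift_heq k b)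
    (L.pathFunctor_shift_heq k p) hx hy hf

/-! ## The shift-invariant part of a family of homotopies on `D•⊢` -/

/-- The **shift-invariant pairs** of a family `K` on `D•⊢`: `(γ₁,γ₂) ∈ E_K` such that every shift `(γ₁+k, γ₂+k)` lies in
`E_K` and carries the same homotopy components (heterogeneously, through the identity of the categories at `x` and
`x + k`) — the condition under which the shift 1-morphisms are compatible with `K` at this pair (Def 3.5 (v);
`shiftInvariant_of_compatibleWith`). [cite: MochizukiAbsTopIII2015, Definition 3.5 (v) p.76] -/
def ShiftInvariantE (K : L.diagram.HomotopyFamily) ⦃a b : DVertex Vmod isArc⦄ (p q : Path a b) : Prop :=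
  K.E p q ∧ ∀ k : ℤ, ∃ h' : K.E ((DVertex.shiftGraph k).mapPath p) ((DVertex.shiftGraph k).mapPath q),
    ∀ (h : K.E p q) (x : L.diagram.obj a) (x' : L.diagram.obj ((DVertex.shiftGraph k).obj a)), HEq x' x →
      HEq ((K.η h').app x') ((K.η h).app x)

variable {L}

/-- Membership in the shift-invariant part, unfolded. [cite: MochizukiAbsTopIII2015, Definition 3.5 (v) p.76] -/
theorem shiftInvariantE_iff (K : L.diagram.HomotopyFamily) {a b : DVertex Vmod isArc} (p q : Path a b) :
    L.ShiftInvariantE K p q ↔ K.E p q ∧ ∀ k : ℤ,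
      ∃ h' : K.E ((DVertex.shiftGraph k).mapPath p) ((DVertex.shiftGraph k).mapPath q),
        ∀ (h : K.E p q) (x : L.diagram.obj a) (x' : L.diagram.obj ((DVertex.shiftGraph k).obj a)), HEq x' x →
          HEq ((K.η h').app x') ((K.η h).app x) :=
  Iff.rfl

/-- **The shift-invariant pairs form a SATURATED set** (§0 p. 26 (a)–(e)): invariance passes to the diagonal (identity
homotopies), to composites (second axiom of Def 3.5 (ii)) and to pre- and post-whiskered pairs (third axiom), because the
shifted path functors are the path functors. [cite: MochizukiAbsTopIII2015, Section 0 p.26] -/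
theorem shiftInvariantE_isSaturated (K : L.diagram.HomotopyFamily) : IsSaturated (L.ShiftInvariantE K) where
  refl_left := by
    rintro a b p q ⟨h, hk⟩
    refine ⟨K.isSaturated.refl_left h, fun k => ?_⟩
    obtain ⟨h', -⟩ := hk k
    refine ⟨K.isSaturated.refl_left h', fun h₀ x x' hx => ?_⟩
    rw [K.η_refl, K.η_refl, NatTrans.id_app, NatTrans.id_app]
    exact CategoryTheory.id_heq_of_heq_obj (L.obj_shift_eq k b) (L.cat_shift_heq k b)
      (L.pathFunctor_shift_obj_heq k p hx)
  refl_right := by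
    rintro a b p q ⟨h, hk⟩
    refine ⟨K.isSaturated.refl_right h, fun k => ?_⟩
    obtain ⟨h', -⟩ := hk k
    refine ⟨K.isSaturated.refl_right h', fun h₀ x x' hx => ?_⟩
    rw [K.η_refl, K.η_refl, NatTrans.id_app, NatTrans.id_app]
    exact CategoryTheory.id_heq_of_heq_obj (L.obj_shift_eq k b) (L.cat_shift_heq k b)
      (L.pathFunctor_shift_obj_heq k q hx)
  trans := by
    rintro a b p q r ⟨h₁, hk₁⟩ ⟨h₂, hk₂⟩
    refine ⟨K.isSaturated.trans h₁ h₂, fun k => ?_⟩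
    obtain ⟨h₁', e₁⟩ := hk₁ k
    obtain ⟨h₂', e₂⟩ := hk₂ k
    refine ⟨K.isSaturated.trans h₁' h₂', fun h₀ x x' hx => ?_⟩
    have El : (K.η (K.isSaturated.trans h₁' h₂')).app x' = (K.η h₁').app x' ≫ (K.η h₂').app x' := by
      rw [K.η_trans h₁' h₂', NatTrans.comp_app]
    have Er : (K.η h₀).app x = (K.η h₁).app x ≫ (K.η h₂).app x := by
      rw [show K.η h₀ = K.η (K.isSaturated.trans h₁ h₂) from rfl, K.η_trans h₁ h₂, NatTrans.comp_app]
    rw [El, Er]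
    exact CategoryTheory.comp_heq_of_heq (L.obj_shift_eq k b) (L.cat_shift_heq k b)
      (L.pathFunctor_shift_obj_heq k p hx) (L.pathFunctor_shift_obj_heq k q hx) (L.pathFunctor_shift_obj_heq k r hx)
      (e₁ h₁ x x' hx) (e₂ h₂ x x' hx)
  precomp := by
    rintro a b c p q ⟨h, hk⟩ r
    refine ⟨K.isSaturated.precomp h r, fun k => ?_⟩
    obtain ⟨h', e⟩ := hk k
    have h'' : K.E ((DVertex.shiftGraph k).mapPath (r.comp p)) ((DVertex.shiftGraph k).mapPath (r.comp q)) := by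
      rw [Prefunctor.mapPath_comp, Prefunctor.mapPath_comp]
      exact K.isSaturated.precomp h' _
    refine ⟨h'', fun h₀ x x' hx => ?_⟩
    -- both sides are the homotopy of `(p, q)` (resp. its shift) at the image of `x` under `𝒟_[r]`
    have hr : HEq ((L.diagram.pathFunctor ((DVertex.shiftGraph k).mapPath r)).obj x') ((L.diagram.pathFunctor r).obj x) :=
      L.pathFunctor_shift_obj_heq k r hx
    have lhs : HEq ((K.η h'').app x')
        ((K.η h').app ((L.diagram.pathFunctor ((DVertex.shiftGraph k).mapPath r)).obj x')) := by
      have h₃ : K.E (((DVertex.shiftGraph k).mapPath r).comp ((DVertex.shiftGraph k).mapPath p))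
          (((DVertex.shiftGraph k).mapPath r).comp ((DVertex.shiftGraph k).mapPath q)) := K.isSaturated.precomp h' _
      refine (K.η_app_heq_of_heq rfl rfl (heq_of_eq (Prefunctor.mapPath_comp _ r p))
        (heq_of_eq (Prefunctor.mapPath_comp _ r q)) h'' h₃ (HEq.refl x')).trans ?_
      exact K.η_app_heq_of_precomp h' _ h₃ x'
    have rhs : HEq ((K.η h₀).app x) ((K.η h).app ((L.diagram.pathFunctor r).obj x)) :=
      K.η_app_heq_of_precomp h r h₀ x
    exact lhs.trans ((e h _ _ hr).trans rhs.symm)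
  postcomp := by
    rintro a b c p q ⟨h, hk⟩ r
    refine ⟨K.isSaturated.postcomp h r, fun k => ?_⟩
    obtain ⟨h', e⟩ := hk k
    have h'' : K.E ((DVertex.shiftGraph k).mapPath (p.comp r)) ((DVertex.shiftGraph k).mapPath (q.comp r)) := by
      rw [Prefunctor.mapPath_comp, Prefunctor.mapPath_comp]
      exact K.isSaturated.postcomp h' _
    refine ⟨h'', fun h₀ x x' hx => ?_⟩
    -- both sides are `𝒟_[r]` (resp. `𝒟_[r + k]`) applied to the homotopy of `(p, q)` (resp. its shift)
    have lhs : HEq ((K.η h'').app x')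
        ((L.diagram.pathFunctor ((DVertex.shiftGraph k).mapPath r)).map ((K.η h').app
          ((L.diagram.pathFunctor (Path.nil : Path ((DVertex.shiftGraph k).obj a) _)).obj x'))) := by
      have h₃ : K.E (Path.nil.comp (((DVertex.shiftGraph k).mapPath p).comp ((DVertex.shiftGraph k).mapPath r)))
          (Path.nil.comp (((DVertex.shiftGraph k).mapPath q).comp ((DVertex.shiftGraph k).mapPath r))) :=
        K.isSaturated.precomp (K.isSaturated.postcomp h' _) _
      refine (K.η_app_heq_of_heq rfl rfl
        (heq_of_eq ((Prefunctor.mapPath_comp _ p r).trans (Path.nil_comp _).symm))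
        (heq_of_eq ((Prefunctor.mapPath_comp _ q r).trans (Path.nil_comp _).symm)) h'' h₃ (HEq.refl x')).trans ?_
      exact K.η_app_heq_map_of_whisker h' Path.nil _ h₃ x'
    have rhs : HEq ((K.η h₀).app x)
        ((L.diagram.pathFunctor r).map ((K.η h).app ((L.diagram.pathFunctor (Path.nil : Path a a)).obj x))) := by
      have h₃ : K.E (Path.nil.comp (p.comp r)) (Path.nil.comp (q.comp r)) :=
        K.isSaturated.precomp (K.isSaturated.postcomp h _) _
      refine (K.η_app_heq_of_heq rfl rfl (heq_of_eq (Path.nil_comp _).symm) (heq_of_eq (Path.nil_comp _).symm) h₀ h₃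
        (HEq.refl x)).trans ?_
      exact K.η_app_heq_map_of_whisker h Path.nil _ h₃ x
    refine lhs.trans (HEq.trans ?_ rhs.symm)
    have hx₀ : HEq ((L.diagram.pathFunctor (Path.nil : Path ((DVertex.shiftGraph k).obj a) _)).obj x')
        ((L.diagram.pathFunctor (Path.nil : Path a a)).obj x) := by
      rw [L.diagram.pathFunctor_nil_obj, L.diagram.pathFunctor_nil_obj]; exact hx
    exact L.pathFunctor_shift_map_heq k r (L.pathFunctor_shift_obj_heq k p hx₀) (L.pathFunctor_shift_obj_heq k q hx₀)
      (e h _ _ hx₀)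

variable (L)

/-- **The shift-invariant part `K^ℤ` of a family of homotopies `K` on `D•⊢`**: the restriction of `K` (same homotopies)
to its shift-invariant pairs. [cite: MochizukiAbsTopIII2015, Definition 3.5 (v) p.76] -/
def shiftInvariantPart (K : L.diagram.HomotopyFamily) : L.diagram.HomotopyFamily :=
  K.restrictBoundary (L.ShiftInvariantE K) (shiftInvariantE_isSaturated K) fun _ _ _ _ h => h.1

variable {L}

/-- The boundary set of `K^ℤ` is the set of shift-invariant pairs of `K`. [cite: MochizukiAbsTopIII2015, Definition 3.5 (v) p.76] -/
theorem shiftInvariantPart_E_iff (K : L.diagram.HomotopyFamily) {a b : DVertex Vmod isArc} (p q : Path a b) :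
    (L.shiftInvariantPart K).E p q ↔ L.ShiftInvariantE K p q :=
  Iff.rfl

/-- The homotopies of `K^ℤ` are those of `K`. [cite: MochizukiAbsTopIII2015, Definition 3.5 (ii) p.75] -/
theorem shiftInvariantPart_η (K : L.diagram.HomotopyFamily) {a b : DVertex Vmod isArc} {p q : Path a b}
    (h : (L.shiftInvariantPart K).E p q) : (L.shiftInvariantPart K).η h = K.η h.1 :=
  rfl

/-- Shifting twice is shifting by the sum, on paths (heterogeneously). [cite: MochizukiAbsTopIII2015, Cor 5.5 (v) p. 132] -/
theorem mapPath_shift_shift_heq (k l : ℤ) {a b : DVertex Vmod isArc} (p : Path a b) :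
    HEq ((DVertex.shiftGraph l).mapPath ((DVertex.shiftGraph k).mapPath p)) ((DVertex.shiftGraph (k + l)).mapPath p) := by
  rw [← Prefunctor.mapPath_comp_apply]
  exact Prefunctor.mapPath_heq_of_eq (DVertex.shiftGraph_comp k l) p

/-- Shifting by `0` fixes paths (heterogeneously). [cite: MochizukiAbsTopIII2015, Cor 5.5 (v) p. 132] -/
theorem mapPath_shift_zero_heq {a b : DVertex Vmod isArc} (p : Path a b) :
    HEq ((DVertex.shiftGraph (0 : ℤ)).mapPath p) p :=
  (Prefunctor.mapPath_heq_of_eq DVertex.shiftGraph_zero p).trans (heq_of_eq (Prefunctor.mapPath_id p))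

/-- **The boundary set of `K^ℤ` is shift-STABLE** (every `k : ℤ`). [cite: MochizukiAbsTopIII2015, Definition 3.5 (v) p.76] -/
theorem shiftInvariantPart_E_iff_shift (K : L.diagram.HomotopyFamily) (k : ℤ) {a b : DVertex Vmod isArc}
    (p q : Path a b) :
    (L.shiftInvariantPart K).E p q ↔
      (L.shiftInvariantPart K).E ((DVertex.shiftGraph k).mapPath p) ((DVertex.shiftGraph k).mapPath q) := by
  -- one direction for every `k` suffices (apply it to `-k` and shift back)
  suffices key : ∀ (k : ℤ) {a b : DVertex Vmod isArc} (p q : Path a b), (L.shiftInvariantPart K).E p q →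
      (L.shiftInvariantPart K).E ((DVertex.shiftGraph k).mapPath p) ((DVertex.shiftGraph k).mapPath q) by
    refine ⟨key k p q, fun h => ?_⟩
    have h' := key (-k) _ _ h
    have ha : (DVertex.shiftGraph (-k)).obj ((DVertex.shiftGraph k).obj a) = a := DVertex.shift_shift_neg k a
    have hb : (DVertex.shiftGraph (-k)).obj ((DVertex.shiftGraph k).obj b) = b := DVertex.shift_shift_neg k b
    have hp : HEq ((DVertex.shiftGraph (-k)).mapPath ((DVertex.shiftGraph k).mapPath p)) p :=
      (mapPath_shift_shift_heq k (-k) p).trans ((Prefunctor.mapPath_heq_of_eq (by rw [Int.add_right_neg]) p).trans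
        (mapPath_shift_zero_heq p))
    have hq : HEq ((DVertex.shiftGraph (-k)).mapPath ((DVertex.shiftGraph k).mapPath q)) q :=
      (mapPath_shift_shift_heq k (-k) q).trans ((Prefunctor.mapPath_heq_of_eq (by rw [Int.add_right_neg]) q).trans
        (mapPath_shift_zero_heq q))
    exact ((L.shiftInvariantPart K).E_iff_of_heq ha hb hp hq).mp h'
  intro k a b p q h
  obtain ⟨h₀, hk⟩ := h
  obtain ⟨hk₀, ek₀⟩ := hk k
  refine ⟨hk₀, fun l => ?_⟩
  obtain ⟨hkl, ekl⟩ := hk (k + l)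
  -- membership of the `l`-shift of the `k`-shifted pair = the `(k+l)`-shift of the pair
  have ha : (DVertex.shiftGraph l).obj ((DVertex.shiftGraph k).obj a) = (DVertex.shiftGraph (k + l)).obj a :=
    (DVertex.shift_add k l a).symm
  have hb : (DVertex.shiftGraph l).obj ((DVertex.shiftGraph k).obj b) = (DVertex.shiftGraph (k + l)).obj b :=
    (DVertex.shift_add k l b).symm
  have hl : K.E ((DVertex.shiftGraph l).mapPath ((DVertex.shiftGraph k).mapPath p))
      ((DVertex.shiftGraph l).mapPath ((DVertex.shiftGraph k).mapPath q)) :=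
    (K.E_iff_of_heq ha hb (mapPath_shift_shift_heq k l p) (mapPath_shift_shift_heq k l q)).mpr hkl
  refine ⟨hl, fun h₁ y y' hy => ?_⟩
  -- compare both with the homotopy of the unshifted pair at a point `y₀` of `𝒟_a` under `y`
  obtain ⟨y₀, hy₀⟩ := exists_heq_cast (L.obj_shift_eq k a) y
  have e₁ : HEq ((K.η h₁).app y) ((K.η h₀).app y₀) := ek₀ h₀ y₀ y hy₀
  have hc : L.diagram.obj ((DVertex.shiftGraph l).obj ((DVertex.shiftGraph k).obj a)) =
      L.diagram.obj ((DVertex.shiftGraph (k + l)).obj a) := congrArg L.diagram.obj ha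
  have e₂ : HEq ((K.η hl).app y') ((K.η hkl).app (cast hc y')) :=
    K.η_app_heq_of_heq ha hb (mapPath_shift_shift_heq k l p) (mapPath_shift_shift_heq k l q) hl hkl
      (cast_heq hc y').symm
  have e₃ : HEq ((K.η hkl).app (cast hc y')) ((K.η h₀).app y₀) :=
    ekl h₀ y₀ _ ((cast_heq hc y').trans (hy.trans hy₀))
  exact e₂.trans (e₃.trans e₁.symm)

/-- **The homotopies of `K^ℤ` are shift-INVARIANT** (through the identity vertex functors `shiftApp`, the form of
`cor55ShiftAction_iff_exists_shiftInvariant`). [cite: MochizukiAbsTopIII2015, Definition 3.5 (v) p.76] -/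
theorem shiftInvariantPart_η_app_heq (K : L.diagram.HomotopyFamily) (k : ℤ) {a b : DVertex Vmod isArc} (p q : Path a b)
    (h : (L.shiftInvariantPart K).E p q)
    (h' : (L.shiftInvariantPart K).E ((DVertex.shiftGraph k).mapPath p) ((DVertex.shiftGraph k).mapPath q))
    (x : L.diagram.obj a) :
    HEq (((L.shiftInvariantPart K).η h').app ((L.shiftApp k a).obj x)) (((L.shiftInvariantPart K).η h).app x) := by
  obtain ⟨h₁, e⟩ := h.2 k
  rw [shiftInvariantPart_η, shiftInvariantPart_η, show K.η h'.1 = K.η h₁ from rfl]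
  exact e h.1 x _ (L.shiftApp_obj_heq k a x)

/-- **F-0157 from the shift-invariant part.**  If the shift-invariant part `K^ℤ` of SOME family of homotopies on `D•⊢`
realises the cores of Cor 5.5 (i) and the observables of Cor 5.5 (iii) (`RealisesCor55Families K^ℤ`, F-0159), then the
`ℤ`-action clause of Cor 5.5 (v) holds (`Cor55ShiftAction L`, F-0157): `K^ℤ` is shift-invariant by construction, and
`cor55ShiftAction_iff_exists_shiftInvariant`. [cite: MochizukiAbsTopIII2015, Cor 5.5 (v) pp. 131–133] -/
theorem cor55ShiftAction_of_realises_shiftInvariantPart (K : L.diagram.HomotopyFamily)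
    (hK : L.RealisesCor55Families (L.shiftInvariantPart K)) : L.Cor55ShiftAction :=
  L.cor55ShiftAction_iff_exists_shiftInvariant.mpr ⟨L.shiftInvariantPart K, hK, fun k =>
    ⟨fun _ _ p q => shiftInvariantPart_E_iff_shift K k p q,
      fun _ _ p q h h' x => shiftInvariantPart_η_app_heq K k p q h h' x⟩⟩

/-- **Criterion for compatibility INTO `K^ℤ`** (used for the cores and observables in the sequel): a family `H` on an extended
sub-diagram embedded in `K` (`CompatibleIn K H`) is embedded in `K^ℤ` as soon as the images of its boundary pairs are
shift-invariant pairs of `K`. [cite: MochizukiAbsTopIII2015, Cor 5.5 (iii) p. 131] -/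
theorem compatibleIn_shiftInvariantPart {K : L.diagram.HomotopyFamily} {P : DVertex Vmod isArc → Prop}
    {x : DVertex Vmod isArc} {H : ((L.subdiagram P).extend (L.obsExt P x)).HomotopyFamily} (hH : L.CompatibleIn K H)
    (hinv : ∀ ⦃a b : (obsShape P x).Vertex⦄ (p q : Path a b), H.E p q →
      L.ShiftInvariantE K ((embExt P x).mapPath p) ((embExt P x).mapPath q)) :
    L.CompatibleIn (L.shiftInvariantPart K) H := fun a b p q h => by
  obtain ⟨h', e⟩ := hH p q h
  exact ⟨hinv p q h, e.trans (heq_of_eq (show K.η h' = K.η (hinv p q h).1 from rfl))⟩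

end LogFrobeniusSetting

end Literature.AnabelianGeometry.AbsoluteAnabelian
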